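import Mathlib
import HarnessLib
import Literature.Computability.AlgebraicComplexity.StandardFamilies
import Summits.ValiantsHypothesis.ValiantsHypothesis.Theorems.MonotoneRestorationOrbitRestorationQPSmlAffineNarrow

/-!
# An exponential lower bound for affine column-set-multilinear `ΣΠΣ` circuits computing the PERMANENT, by symmetry
(crux `OrbitRestorationQP`, stmt-ValiantsHypothesis-18293 — lane SML of stub A_∞; the LOWER-BOUND content of the affine stratum
made concrete on the route's deciding family)

`SmlAffineNarrow.narrow_component_of_affineColSml_lt_choose` says: a row- and column-symmetric affine column-set-multilinear
`ΣΠΣ` expression with fewer than `C(n-j, j)` product gates (`2j ≤ n`) has a symmetric shadow all of whose homogeneous components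
are `(j-1)`-narrow in power sums.  The permanent `per_n = Σ_σ Π_i x_{(σ i, i)}` is matrix-symmetric and its shadow is
`rename fst per_n = n! · y_1 ⋯ y_n = n! · e_n(y)`, which is NOT `(j-1)`-narrow for any `j ≤ n/2`: the disjoint-pair difference
derivation `Δ = Π_{i<j} (∂_{y_{2i}} - ∂_{y_{2i+1}})` kills every narrow power-sum product (`(N1)`,
`SmlDeltaCalculus.deltaFold_psumProd_eq_zero_of_narrow`) but `Δ (y_1⋯y_n) ≠ 0` (evaluate at the indicator of the odd positions).
Hence:

* `pderivFold_prod_X` — iterated partials of the square-free monomial `Π_{k∈U} y_k` along an injective tuple;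
* `deltaFold_prod_X_ne_zero` — `Δ (Π_k y_k) ≠ 0` for `j` disjoint pairs;
* `rename_fst_perPoly` — `rename fst per_n = n! • Π_k y_k`;
* `perm_affineColSml_lower_bound` — **every affine column-set-multilinear depth-three expression of the permanent,
  `per_n = Σ_{t<s} Π_{b<n} (β_{t,b} + Σ_a α_{t,b,a} x_{(a,b)})`, has `s ≥ C(n-j, j)` product gates for every `j` with `2j ≤ n`**
  (e.g. `j = ⌊n/3⌋`: `s ≥ C(⌈2n/3⌉, ⌊n/3⌋) = 2^{Ω(n)}`).

Set-multilinear depth-three lower bounds for the permanent are classical (Nisan–Wigderson partial-derivative method); the point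
here is the route's mechanism: the bound comes from SYMMETRY (column symmetry collapses the flattenings of the shadow) and it is
exactly what separates the landed stratum (poly-size affine col-sml ⇒ restorable) from the permanent (not restorable,
Dawar–Wilsenach Thm 7.1).  Honest label: a lower bound for a restricted circuit class; nothing here bears on general `ΣΠΣ` or on
VP ≠ VNP. [folklore; cf. NisanWigderson1996 for the partial-derivative route]
-/

noncomputable section

open scoped Classical

-- `Summit.ValiantsHypothesis.ValiantsHypothesis.…` is the tree's single-conjunct layout (Sub = Summit).
set_option linter.dupNamespace false

namespace Summit.ValiantsHypothesis.ValiantsHypothesis.Theorems.SmlAffinePermanent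

open MvPolynomial Finset Equiv Literature.Computability.AlgebraicComplexity SmlDeltaCalculus SmlChainRule SmlFlattening
  SmlAffineNarrow

/-! ### Iterated partials of a square-free monomial -/

/-- `∂_i (Π_{k∈U} y_k) = Π_{k ∈ U∖{i}} y_k` for `i ∈ U`. [folklore] -/
theorem pderiv_prod_X_of_mem {σ : Type*} [DecidableEq σ] {U : Finset σ} {i : σ} (hi : i ∈ U) :
    pderiv i (∏ k ∈ U, (X k : MvPolynomial σ ℂ)) = ∏ k ∈ U.erase i, X k := by
  rw [← Finset.mul_prod_erase U _ hi, pderiv_mul, pderiv_X_self, one_mul,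
    pderiv_prod_eq_zero _ _ _ (fun k hk => pderiv_X_of_ne (Finset.ne_of_mem_erase hk)), mul_zero, add_zero]

/-- **Iterated partials of a square-free monomial along an injective tuple** remove the differentiated variables. [folklore] -/
theorem pderivFold_prod_X {σ : Type*} [DecidableEq σ] :
    ∀ (j : ℕ) (c : Fin j → σ), Function.Injective c → ∀ U : Finset σ, (∀ i, c i ∈ U) →
      List.foldl (fun (q : MvPolynomial σ ℂ) i => pderiv (c i) q) (∏ k ∈ U, X k) (List.finRange j) =
        ∏ k ∈ U \ Finset.univ.image c, X k := by
  intro j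
  induction j with
  | zero => intro c _ U _; simp
  | succ j ih =>
    intro c hc U hU
    rw [List.finRange_succ, List.foldl_cons, List.foldl_map, pderiv_prod_X_of_mem (hU 0)]
    rw [show (List.foldl (fun (q : MvPolynomial σ ℂ) i => pderiv (c i.succ) q) (∏ k ∈ U.erase (c 0), X k)
        (List.finRange j)) = List.foldl (fun (q : MvPolynomial σ ℂ) i => pderiv ((fun i => c i.succ) i) q)
        (∏ k ∈ U.erase (c 0), X k) (List.finRange j) from rfl,
      ih (fun i => c i.succ) (hc.comp (Fin.succ_injective j)) (U.erase (c 0))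
        (fun i => Finset.mem_erase.2 ⟨fun h => Fin.succ_ne_zero i (hc h), hU i.succ⟩)]
    congr 1
    ext k
    simp only [Finset.mem_sdiff, Finset.mem_erase, Finset.mem_image, Finset.mem_univ, true_and, not_exists]
    constructor
    · rintro ⟨⟨hne, hkU⟩, hno⟩
      exact ⟨hkU, fun i => Fin.cases (Ne.symm hne) (fun i => hno i) i⟩
    · rintro ⟨hkU, hno⟩
      exact ⟨⟨fun h => hno 0 h.symm, hkU⟩, fun i => hno i.succ⟩

/-! ### The disjoint-pair difference derivation does not kill `y_1 ⋯ y_n` -/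

/-- **`Δ (Π_k y_k) ≠ 0`** for pairs `(a i, b i)` with `a`, `b` injective and `a i ≠ b i'`: evaluate the bool-expansion of `Δ` at the
point `y_k = [k ∉ im a]`; only the summand `∂_{a}` survives. [folklore] -/
theorem deltaFold_prod_X_ne_zero {n j : ℕ} (a b : Fin j → Fin n) (ha : Function.Injective a)
    (hb : Function.Injective b) (hab : ∀ i i', a i ≠ b i') :
    List.foldl (fun (q : MvPolynomial (Fin n) ℂ) i => pderiv (a i) q - pderiv (b i) q)
      (∏ k : Fin n, X k) (List.finRange j) ≠ 0 := by
  classical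
  -- the mixed tuples are injective
  have hinj : ∀ ε : Fin j → Bool, Function.Injective fun i => if ε i then b i else a i := by
    intro ε i i' h
    dsimp only at h
    split_ifs at h with h1 h2 h2
    · exact hb h
    · exact absurd h.symm (hab i' i)
    · exact absurd h (hab i i')
    · exact ha h
  have hfold : ∀ ε : Fin j → Bool,
      List.foldl (fun (q : MvPolynomial (Fin n) ℂ) i => pderiv (if ε i then b i else a i) q)
        (∏ k : Fin n, X k) (List.finRange j) =
        ∏ k ∈ Finset.univ \ Finset.univ.image (fun i => if ε i then b i else a i), X k :=
    fun ε => pderivFold_prod_X j (fun i => if ε i then b i else a i) (hinj ε) Finset.univ (fun _ => Finset.mem_univ _)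
  rw [deltaFold_eq_sum_bool]
  simp_rw [hfold]
  -- evaluate at the indicator of the complement of `im a`
  set v : Fin n → ℂ := fun k => if k ∈ Finset.univ.image a then 0 else 1 with hv
  have hterm : ∀ ε : Fin j → Bool,
      MvPolynomial.eval v (∏ k ∈ Finset.univ \ Finset.univ.image (fun i => if ε i then b i else a i),
        (X k : MvPolynomial (Fin n) ℂ)) = if ε = fun _ => false then 1 else 0 := by
    intro ε
    rw [map_prod]
    simp only [eval_X]
    by_cases hε : ε = fun _ => false
    · rw [if_pos hε]
      refine Finset.prod_eq_one fun k hk => ?_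
      rw [hv]; dsimp only
      rw [if_neg]
      subst hε
      simpa using hk
    · rw [if_neg hε]
      obtain ⟨i, hi⟩ : ∃ i, ε i = true := by
        by_contra hcon
        push Not at hcon
        exact hε (funext fun i => by simpa using hcon i)
      refine Finset.prod_eq_zero (i := a i) ?_ ?_
      · simp only [Finset.mem_sdiff, Finset.mem_univ, true_and, Finset.mem_image, not_exists]
        intro i' h
        by_cases h' : ε i' = true
        · rw [if_pos h'] at h; exact hab i i' h.symm
        · rw [if_neg h'] at h
          have := ha h
          subst this
          exact h' hi
      · rw [hv]; dsimp only
        rw [if_pos (Finset.mem_image_of_mem _ (Finset.mem_univ i))]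
  intro h0
  have h1 := congrArg (MvPolynomial.eval v) h0
  rw [map_sum, map_zero] at h1
  simp_rw [map_zsmul, hterm] at h1
  rw [Finset.sum_eq_single (fun _ => false)] at h1
  · simp at h1
  · intro ε _ hne; rw [if_neg hne, smul_zero]
  · intro h; exact absurd (Finset.mem_univ _) h

/-! ### The symmetric shadow of the permanent -/

/-- **`rename fst per_n = n! • Π_k y_k`.** [folklore] -/
theorem rename_fst_perPoly (n : ℕ) :
    rename (Prod.fst : Fin n × Fin n → Fin n) (perPoly (Fin n) ℂ) = ((n.factorial : ℕ) : ℂ) • ∏ k : Fin n, X k := by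
  have hper : perPoly (Fin n) ℂ = ∑ σ : Equiv.Perm (Fin n), ∏ i, (X (σ i, i) : MvPolynomial (Fin n × Fin n) ℂ) := by
    rw [perPoly, Matrix.permanent]; rfl
  rw [hper, map_sum]
  simp only [map_prod, rename_X]
  rw [Finset.sum_congr rfl (fun σ _ => Equiv.prod_comp σ (fun i => (X i : MvPolynomial (Fin n) ℂ))),
    Finset.sum_const, Finset.card_univ, Fintype.card_perm, Fintype.card_fin, ← Nat.cast_smul_eq_nsmul ℂ]

/-- The permanent over `ℂ` is matrix-symmetric (as in `MonotoneRestorationQP.Negative.rename_perm_perPoly`, over `ℂ`).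
[folklore] -/
theorem rename_perm_perPoly_complex (n : ℕ) (σ τ : Equiv.Perm (Fin n)) :
    rename (fun p : Fin n × Fin n => (σ p.1, τ p.2)) (perPoly (Fin n) ℂ) = perPoly (Fin n) ℂ := by
  have h1 : rename (fun p : Fin n × Fin n => (σ p.1, τ p.2)) (perPoly (Fin n) ℂ) =
      ((Matrix.mvPolynomialX (Fin n) (Fin n) ℂ).submatrix σ τ).permanent := by
    simp only [perPoly, Matrix.permanent, map_sum, map_prod, Matrix.mvPolynomialX_apply, rename_X, Matrix.submatrix_apply]
  rw [h1]
  have h2 : ((Matrix.mvPolynomialX (Fin n) (Fin n) ℂ).submatrix (σ : Fin n → Fin n) (τ : Fin n → Fin n)) =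
      (((Matrix.mvPolynomialX (Fin n) (Fin n) ℂ).submatrix id (τ : Fin n → Fin n)).submatrix (σ : Fin n → Fin n) id) := by
    ext i j; simp
  rw [h2, Matrix.permanent_permute_cols, Matrix.permanent_permute_rows]
  rfl

/-! ### The lower bound -/

/-- **EXPONENTIAL LOWER BOUND FOR AFFINE COLUMN-SET-MULTILINEAR `ΣΠΣ` CIRCUITS COMPUTING THE PERMANENT.**  If
`per_n = Σ_{t<s} Π_{b<n} (β_{t,b} + Σ_a α_{t,b,a} x_{(a,b)})`, then `s ≥ C(n-j, j)` for every `j` with `2j ≤ n`. [folklore] -/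
theorem perm_affineColSml_lower_bound {n s j : ℕ} (h2j : 2 * j ≤ n) (β : Fin s → Fin n → ℂ)
    (α : Fin s → Fin n → Fin n → ℂ)
    (hper : (∑ t : Fin s, ∏ b : Fin n, (C (β t b) + ∑ a : Fin n, C (α t b a) * X (a, b)) :
      MvPolynomial (Fin n × Fin n) ℂ) = perPoly (Fin n) ℂ) :
    Nat.choose (n - j) j ≤ s := by
  classical
  by_contra hs
  rw [not_le] at hs
  have hrow : ∀ σ : Equiv.Perm (Fin n), rename (fun v : Fin n × Fin n => (σ v.1, v.2))
      (∑ t : Fin s, ∏ b : Fin n, (C (β t b) + ∑ a : Fin n, C (α t b a) * X (a, b)) :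
        MvPolynomial (Fin n × Fin n) ℂ) =
      ∑ t : Fin s, ∏ b : Fin n, (C (β t b) + ∑ a : Fin n, C (α t b a) * X (a, b)) := by
    intro σ; rw [hper]; simpa using rename_perm_perPoly_complex n σ 1
  have hcol : ∀ τ : Equiv.Perm (Fin n), rename (fun v : Fin n × Fin n => (v.1, τ v.2))
      (∑ t : Fin s, ∏ b : Fin n, (C (β t b) + ∑ a : Fin n, C (α t b a) * X (a, b)) :
        MvPolynomial (Fin n × Fin n) ℂ) =
      ∑ t : Fin s, ∏ b : Fin n, (C (β t b) + ∑ a : Fin n, C (α t b a) * X (a, b)) := by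
    intro τ; rw [hper]; simpa using rename_perm_perPoly_complex n 1 τ
  obtain ⟨S, c, hS, hcomp⟩ := narrow_component_of_affineColSml_lt_choose h2j β α hrow hcol hs n
  rw [hper, rename_fst_perPoly, map_smul] at hcomp
  have hhom : (∏ k : Fin n, (X k : MvPolynomial (Fin n) ℂ)).IsHomogeneous n := by
    have h := IsHomogeneous.prod (Finset.univ : Finset (Fin n)) (fun k : Fin n => (X k : MvPolynomial (Fin n) ℂ))
      (fun _ => 1) (fun k _ => isHomogeneous_X ℂ k)
    simpa using h
  rw [homogeneousComponent_of_mem ((mem_homogeneousSubmodule n _).2 hhom), if_pos rfl] at hcomp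
  -- the disjoint pairs `(2i, 2i+1)`
  let a : Fin j → Fin n := fun i => ⟨2 * (i : ℕ), by omega⟩
  let b : Fin j → Fin n := fun i => ⟨2 * (i : ℕ) + 1, by omega⟩
  have ha : Function.Injective a := by
    intro i i' h; simp only [a, Fin.mk.injEq] at h; exact Fin.ext (by omega)
  have hb : Function.Injective b := by
    intro i i' h; simp only [b, Fin.mk.injEq] at h; exact Fin.ext (by omega)
  have hab : ∀ i i', a i ≠ b i' := by
    intro i i' h; simp only [a, b, Fin.mk.injEq] at h; omega
  have hΔ := congrArg (fun q => List.foldl (fun (q : MvPolynomial (Fin n) ℂ) i => pderiv (a i) q - pderiv (b i) q) q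
    (List.finRange j)) hcomp
  rw [deltaFoldList_smul, deltaFoldList_sum] at hΔ
  rw [Finset.sum_eq_zero (fun μ hμ => by
    obtain ⟨hpos, _, hcard⟩ := hS μ hμ
    rw [deltaFoldList_smul, deltaFold_psumProd_eq_zero_of_narrow j a b ha hb hab μ hpos hcard, smul_zero])] at hΔ
  have hN : ((n.factorial : ℕ) : ℂ) ≠ 0 := by exact_mod_cast Nat.factorial_ne_zero n
  exact deltaFold_prod_X_ne_zero a b ha hb hab ((smul_eq_zero.1 hΔ).resolve_left hN)

end Summit.ValiantsHypothesis.ValiantsHypothesis.Theorems.SmlAffinePermanent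

end
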